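import Summits.QuantumFields.BalabanUV.T4Continuum.Support.NE7TangentTransportRightInv
import Summits.QuantumFields.BalabanUV.T4Continuum.Support.NE7QbarLipschitzTower
import HarnessLib

/-!
# NE7CriticalFirstVariation — TANGENT-CRITICALITY ⟹ B8's REGULARITY INPUT (1.9): at a representative with flat top average, the first variation of the
# Wilson action of a TANGENT-CRITICAL configuration has `(ℓ¹)*`-density `c_R·(Λ + (L∕L^d)^{k+1})` on ALL skew periodic directions — in the currencies of the
# (APE)-bill (`c_R = a·C·M^{d−2}`, `Λ = 2C_Sα̂M^{1−d}`, `a = δM⁻²`) this is `C′·δ·M⁻³`, i.e. `|D*F| < α₀η³` with `α₀ ∝ δ`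

Cell `pub-balaban`, rung (B)+1 sub-cell t4, lineage `b2b-balaban-t4-ne7-p1`, generation 72 (CRUX PROVER NE7 #1).  File R1 of the REP♭ road (memo
`t4/b2b-balaban-t4-ne7-p1-g72/HUNT-H16-GREEN-DISCHARGED.md` §7); over F52 `NE7TangentTransportGauge`, F53 `NE7TangentTransportRightInv`, F50 `NE7QbarLipschitzTower`.
WHY.  After p2's (155) `NE7ApeTrivialFlatEndDischarged` the only displayed Bałaban TYPE of (APE) at the trivial flat datum is REP♭ (i): [B8] Theorem 2's output
(a gauge `u₀` with `U^{u₀} = e^{A₀}`, `‖A₀‖ ≤ a₀`, `‖∇A₀‖ ≤ a₁`).  [B8] Theorem 2 asks of the configuration the regularity class `𝔄_k` of (1.7)–(1.9) p. 77: small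
plaquettes (1.7) — the bootstrap radius `δM⁻²` — AND the bond condition (1.9), a bound on the covariant divergence of the field strength, `|D*F| < α₀η³(Lʲη)⁻³`.
For the configurations of the (APE)-bill — TANGENT-CRITICAL points of the Wilson action on the averaging fibre — (1.9) is NOT a hypothesis but a CONSEQUENCE of
criticality: the first variation is a coarse multiplier paired with the linearised average, `dAction_U Z = dAction_U(R(D_UZ))`, and the frames of `D_U` are
absorbed by a fine gauge direction on which the first variation vanishes EXACTLY (F52's mechanism), so only the straight double-bar tower `Q̄_U` is paid for:
`|dAction_U Z| ≤ c_R·‖Q̄_UZ‖₁ ≤ c_R(Λ + (L∕L^d)^{k+1})‖Z‖₁`.  THIS FILE proves that letter; it is the `α₀`-input of any bridge from [B8] Theorem 2 to REP♭.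
WHAT ([folklore]; 0 def, 0 sorry; generic `d`).  §1 **`dirIter_add_gaugeDir_eq_Qbar`**: for ANY skew periodic `Z`, with the corner lift `λ` of `−framePotW L (k+1) U Z`,
`D_U(Z + gaugeDir_U λ) = Q̄^{(k+1)}_U Z` when `cavgIter L (k+1) U = 1` (F52's §2 without the flat-tangency of `Z`).  §2 **`abs_dAction_le_of_tanCritical_gauge`**
(abstract exact right inverse `R` with first-variation bound `c_R`, as F52) and **`abs_dAction_le_of_tanCritical`** (`R := rightInvW`, `c_R = a·(curl1C∕(1−θℓ))·M^d∕M²`,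
as F53): for `U` unitary `(N·L^{k+1})`-periodic in the W5∕W6 regime with `SmallField U a`, flat top average, TANGENT-CRITICAL, and the straight-tower letter `Λ`:
`|dAction U Z (perWin)| ≤ c_R·(Λ + (L∕L^d)^{k+1})·‖Z‖_{ℓ¹(periodBox (N·L^{k+1}))}` for EVERY skew `(N·L^{k+1})`-periodic `Z`.  §3 `density_currency`: with `a = δM⁻²`
and `Λ = 2C_Sα̂(L∕L^d)^{k+1}` the density equals `C·δ·(1 + 2C_Sα̂)·M⁻³` — [B8] (1.9)'s `α₀η³` with `α₀ = C(1 + 2C_Sα̂)δ`.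
HONEST FRAMING (page 1): a composition of tree theorems (F52∕F53∕F50; row NE3's right inverse); nothing of Bałaban's asserted — [B8] (1.9) p. 77 is a TEXT
LOCATION; [B8] Theorem 2 is NOT proved here and REP♭ stays a hypothesis of the END; NOT (APE), NOT ONE-STEP, NOT NE7; spine 0∕9; finite T⁴ rung (B)+1 — NOT
infinite volume, NOT mass gap, NOT Clay.  Continuum YM on T⁴ ⇐ BetaPertH ∧ nine spine estimates (0/9 proved); BetaPertH ⇐ (D1) ∧ (D4) ∧ CAP+tail; G-an2-4 gates
asym, D1 and NE2/3/4.
-/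

set_option autoImplicit false

open scoped BigOperators Matrix.Norms.L2Operator
open NormedSpace Finset

namespace Summit.QuantumFields.BalabanUV.T4Continuum.NE7CriticalFirstVariation

open Literature.MathematicalPhysics.QuantumFieldTheory.Balaban1983to89
open B7Prop1Explicit B7Prop2Explicit MatrixLog UnitaryModel
open T4AveragingDeficitWall (IsUnitaryCfg IsSkewDir SmallField dirL1 flat_mem_classes)
open T4AveragingDeficitWallBoundary (IsPeriodicCfg periodBox)
open AveragingDeficitPeriodicCounting (IsPeriodicDir)
open AveragingDeficitMultiLevelPrep (cavgIter LevelSmall tower)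
open AveragingDeficitMultiLevelBridge (tower_eq)
open MinimalActionLevels (perWin)
open BlockAveragePushDirGauge (gaugeDir isPeriodicDir_gaugeDir)
open BlockAveragePushDirSplit (flat)
open NE3TangentNoGoWords (dPot)
open NE3TangentFlatStructure (Qcoarse)
open NE3TangentCovariantTower (dirIter QbarIter framePotW dirIter_add dirIter_gaugeDir dirIter_eq_QbarIter_add_gaugeDir QbarIter_flat gaugeDir_flat)
open NE3CurvedFrameKill (framePotW_skew_periodic pow_succ_mul_eq_tower)
open NE3LandauOrbit (gaugeDir_skew)
open NE3ResidualSliceRep (dirIter_sub)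
open NE3HessForm (dAction)
open NE3PureGaugeFirstVariation (dAction_gaugeDir)
open NE3QbarIterCovLiftPrep (cruxC)
open NE3SmoothRightInverseW (rightInvW)
open NE3RightInverseSolveLetters (thetaLoc)
open NE3HatInvCurlLetters (curl1C curl1C_nonneg)
open NE3RightInverseLetters (rightInvW_exact rightInvW_skew rightInvW_periodic)
open NE7TangentTransportGauge (dAction_sub' dirIter_skew_periodic cornerLift_smul cornerLift_add_period)
open NE7TangentTransportRightInv (abs_dAction_rightInvW_le)
open NE7QbarLipschitzTower (sum_norm_iterate_Qcoarse_le)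

noncomputable section

variable {d : ℕ} {n : Type*} [Fintype n] [DecidableEq n]

/-! ## §1 Absorbing the frames of the linearised average by a fine gauge direction (any skew periodic direction) -/

/-- **`D_U(Z + gaugeDir_U λ) = Q̄^{(k+1)}_U Z`** for the corner lift `λ` of `−framePotW L (k+1) U Z`, when the top average of `U` is flat: the structure theorem
`D_U Z = Q̄_U Z + gaugeDir_{Ů}(F_U Z)` (row NE3), `Ů = 1`, `gaugeDir_1 = −dPot`, and `D_U(gaugeDir_U λ) = gaugeDir_Ů(λ∘M•) = −dPot(λ∘M•) = dPot(F_U Z)`.  No tangency of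
`Z` is needed (F52 §2 is the tangent-at-`1` case, where additionally `Q^{(k+1)}Z = dPot(F_1 Z)` is subtracted). [folklore] -/
theorem dirIter_add_gaugeDir_eq_Qbar [Nonempty n] {L N : ℕ} [NeZero N] (hL : 1 ≤ L) (k : ℕ)
    {U : Site d → Fin d → (Matrix n n ℂ)ˣ} {x : ℝ} (hUu : IsUnitaryCfg U) (hUP : IsPeriodicCfg U ((tower L N (k + 1) : ℕ) : ℤ))
    (hx : 0 ≤ x) (hs : LevelSmall d L k x) (hUx : SmallField U x) (hflatTop : cavgIter L (k + 1) U = flat)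
    {Z : Site d → Fin d → Matrix n n ℂ} (hZ : IsSkewDir Z) (hZP : IsPeriodicDir Z ((tower L N (k + 1) : ℕ) : ℤ)) (z : Site d) (κ : Fin d) :
    dirIter L (k + 1) U (fun y μ => Z y μ
        + gaugeDir U (fun xx : Site d => (fun w => -framePotW L (k + 1) U Z w) (fun i => xx i / ((L : ℤ) ^ (k + 1)))) y μ) z κ
      = QbarIter L (k + 1) U Z z κ := by
  have hm : ((L : ℤ) ^ (k + 1)) ≠ 0 := pow_ne_zero _ (by exact_mod_cast (show L ≠ 0 by omega))
  have htow : ((tower L N (k + 1) : ℕ) : ℤ) = (L : ℤ) ^ (k + 1) * (N : ℤ) := (pow_succ_mul_eq_tower L N k).symm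
  set g : Site d → Matrix n n ℂ := fun w => -framePotW L (k + 1) U Z w with hg
  obtain ⟨hFUs, hFUP⟩ := framePotW_skew_periodic (M := N) hL k hUu hUP hx hs hUx hZ hZP
  have hgs : ∀ w, g w ∈ skewAdjoint (Matrix n n ℂ) := fun w => (skewAdjoint (Matrix n n ℂ)).neg_mem (hFUs w)
  have hgP : ∀ (w : Site d) (i : Fin d), g (w + (N : ℤ) • e i) = g w := fun w i => by simp only [hg, hFUP w i]
  set lam : Site d → Matrix n n ℂ := fun xx => g (fun i => xx i / ((L : ℤ) ^ (k + 1))) with hlam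
  have hlams : ∀ xx, lam xx ∈ skewAdjoint (Matrix n n ℂ) := fun xx => hgs _
  have hlamP : ∀ (y : Site d) (i : Fin d), lam (y + ((tower L N (k + 1) : ℕ) : ℤ) • e i) = lam y := fun y i => by
    rw [htow]; exact cornerLift_add_period g hm hgP y i
  have hlam_corner : (fun y : Site d => lam (((L : ℤ) ^ (k + 1)) • y)) = g := by
    funext y; exact cornerLift_smul g hm y
  have hadd := dirIter_add hL k hUu hx hs hUx Z (gaugeDir U lam)
  have hgauge := dirIter_gaugeDir (M := N) hL k hUu hUP hx hs hUx hlams hlamP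
  have hstr := dirIter_eq_QbarIter_add_gaugeDir (M := N) hL k hUu hUP hx hs hUx hZ hZP
  have h1 := congr_fun (congr_fun hadd z) κ
  have h2 := congr_fun (congr_fun hgauge z) κ
  have h3 := congr_fun (congr_fun hstr z) κ
  rw [h1, h2, h3, hflatTop, hlam_corner, gaugeDir_flat, gaugeDir_flat]
  simp only [dPot, hg]
  abel

/-! ## §2 The first variation of a tangent-critical configuration, tested against ALL skew periodic directions -/

/-- **THE FIRST-VARIATION DENSITY OF A TANGENT-CRITICAL CONFIGURATION (abstract right inverse).**  Data as F52 `tangent_transport_gauge` (`U` unitary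
`T`-periodic, `T = L^{k+1}·N`, multi-level class, FLAT TOP AVERAGE; an exact right inverse `R` of `D_U` on skew `N`-periodic coarse data with first-variation bound
`c_R`; the straight-tower letter `Λ`) PLUS tangent-criticality of `U` (`dAction_U Y′ = 0` for skew `T`-periodic `Y′` with `D_UY′ = 0`).  THEN for EVERY skew
`T`-periodic `Z`: `|dAction U Z (perWin d T)| ≤ c_R·(Λ + (L∕L^d)^{k+1})·‖Z‖_{ℓ¹(periodBox T)}`.  PROOF: `dAction_U Z = dAction_U(Z + gaugeDir_Uλ)` (the first variation
kills gauge directions EXACTLY), `D_U(Z + gaugeDir_Uλ) = Q̄_UZ =: ψ` (§1), `Z + gaugeDir_Uλ − Rψ` is tangent so criticality gives `dAction_U(Z + gaugeDir_Uλ) =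
dAction_U(Rψ)`, `|·| ≤ c_R‖ψ‖₁`, and `‖Q̄_UZ‖₁ ≤ ‖Q̄_UZ − Q^{(k+1)}Z‖₁ + ‖Q^{(k+1)}Z‖₁ ≤ (Λ + (L∕L^d)^{k+1})‖Z‖₁` (F50). [folklore] -/
theorem abs_dAction_le_of_tanCritical_gauge [Nonempty n] {L N : ℕ} [NeZero N] (hL : 1 ≤ L) (k : ℕ)
    {U : Site d → Fin d → (Matrix n n ℂ)ˣ} {x : ℝ} (hUu : IsUnitaryCfg U) (hUP : IsPeriodicCfg U ((tower L N (k + 1) : ℕ) : ℤ))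
    (hx : 0 ≤ x) (hs : LevelSmall d L k x) (hUx : SmallField U x) (hflatTop : cavgIter L (k + 1) U = flat)
    (R : (Site d → Fin d → Matrix n n ℂ) → Site d → Fin d → Matrix n n ℂ)
    (hRskew : ∀ φ : Site d → Fin d → Matrix n n ℂ, IsSkewDir φ → IsPeriodicDir φ (N : ℤ) → IsSkewDir (R φ))
    (hRper : ∀ φ : Site d → Fin d → Matrix n n ℂ, IsSkewDir φ → IsPeriodicDir φ (N : ℤ) →
      IsPeriodicDir (R φ) ((tower L N (k + 1) : ℕ) : ℤ))
    (hRexact : ∀ φ : Site d → Fin d → Matrix n n ℂ, IsSkewDir φ → IsPeriodicDir φ (N : ℤ) → dirIter L (k + 1) U (R φ) = φ)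
    {cR : ℝ} (hcR : 0 ≤ cR)
    (hRbd : ∀ φ : Site d → Fin d → Matrix n n ℂ, IsSkewDir φ → IsPeriodicDir φ (N : ℤ) →
      |dAction U (R φ) (perWin d (tower L N (k + 1)))| ≤ cR * dirL1 φ (periodBox (d := d) N))
    {Λ : ℝ}
    (hΛ : ∀ Y : Site d → Fin d → Matrix n n ℂ, IsSkewDir Y → IsPeriodicDir Y ((tower L N (k + 1) : ℕ) : ℤ) →
      ∑ z ∈ periodBox N, ∑ κ : Fin d, ‖QbarIter L (k + 1) U Y z κ - QbarIter L (k + 1) (flat (d := d) (n := n)) Y z κ‖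
        ≤ Λ * dirL1 Y (periodBox (d := d) (tower L N (k + 1))))
    (hcrit : ∀ Y' : Site d → Fin d → Matrix n n ℂ, IsSkewDir Y' → IsPeriodicDir Y' ((tower L N (k + 1) : ℕ) : ℤ) →
      dirIter L (k + 1) U Y' = 0 → dAction U Y' (perWin d (tower L N (k + 1))) = 0)
    {Z : Site d → Fin d → Matrix n n ℂ} (hZ : IsSkewDir Z) (hZP : IsPeriodicDir Z ((tower L N (k + 1) : ℕ) : ℤ)) :
    |dAction U Z (perWin d (tower L N (k + 1)))|
      ≤ cR * (Λ + ((L : ℝ) / (L : ℝ) ^ d) ^ (k + 1)) * dirL1 Z (periodBox (d := d) (tower L N (k + 1))) := by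
  have hm : ((L : ℤ) ^ (k + 1)) ≠ 0 := pow_ne_zero _ (by exact_mod_cast (show L ≠ 0 by omega))
  have htow : ((tower L N (k + 1) : ℕ) : ℤ) = (L : ℤ) ^ (k + 1) * (N : ℤ) := (pow_succ_mul_eq_tower L N k).symm
  have htowN : tower L N (k + 1) = L ^ (k + 1) * N := by rw [tower_eq]; ring
  have hN1 : 1 ≤ N := Nat.one_le_iff_ne_zero.mpr (NeZero.ne N)
  -- the generator of §1 and its letters
  set g : Site d → Matrix n n ℂ := fun w => -framePotW L (k + 1) U Z w with hg
  set lam : Site d → Matrix n n ℂ := fun xx => g (fun i => xx i / ((L : ℤ) ^ (k + 1))) with hlam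
  obtain ⟨hFUs, hFUP⟩ := framePotW_skew_periodic (M := N) hL k hUu hUP hx hs hUx hZ hZP
  have hgs : ∀ w, g w ∈ skewAdjoint (Matrix n n ℂ) := fun w => (skewAdjoint (Matrix n n ℂ)).neg_mem (hFUs w)
  have hgP : ∀ (w : Site d) (i : Fin d), g (w + (N : ℤ) • e i) = g w := fun w i => by simp only [hg, hFUP w i]
  have hlams : ∀ xx, lam xx ∈ skewAdjoint (Matrix n n ℂ) := fun xx => hgs _
  have hlamP : ∀ (y : Site d) (i : Fin d), lam (y + ((tower L N (k + 1) : ℕ) : ℤ) • e i) = lam y := fun y i => by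
    rw [htow]; exact cornerLift_add_period g hm hgP y i
  -- the gauge-corrected direction `Z₁ = Z + gaugeDir_U λ` and its average `ψ = Q̄_U Z`
  set G : Site d → Fin d → Matrix n n ℂ := gaugeDir U lam with hG
  have hGs : IsSkewDir G := gaugeDir_skew hUu hlams
  have hGP : IsPeriodicDir G ((tower L N (k + 1) : ℕ) : ℤ) := isPeriodicDir_gaugeDir hUP hlamP
  set Z₁ : Site d → Fin d → Matrix n n ℂ := fun y μ => Z y μ + G y μ with hZ₁
  have hZ₁s : IsSkewDir Z₁ := fun y μ => (skewAdjoint (Matrix n n ℂ)).add_mem (hZ y μ) (hGs y μ)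
  have hZ₁P : IsPeriodicDir Z₁ ((tower L N (k + 1) : ℕ) : ℤ) := fun y i μ => by simp only [hZ₁, hZP y i μ, hGP y i μ]
  set ψ : Site d → Fin d → Matrix n n ℂ := dirIter L (k + 1) U Z₁ with hψ
  obtain ⟨hψs, hψP⟩ := dirIter_skew_periodic (M := N) hL k hUu hUP hx hs hUx hZ₁s hZ₁P
  have hψeq : ∀ (w : Site d) (τ : Fin d), ψ w τ = QbarIter L (k + 1) U Z w τ :=
    fun w τ => dirIter_add_gaugeDir_eq_Qbar hL k hUu hUP hx hs hUx hflatTop hZ hZP w τ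
  -- the tangent field `Z₁ − Rψ` and criticality
  have hTs : IsSkewDir (fun y μ => Z₁ y μ - R ψ y μ) := fun y μ => (skewAdjoint (Matrix n n ℂ)).sub_mem (hZ₁s y μ) (hRskew ψ hψs hψP y μ)
  have hTP : IsPeriodicDir (fun y μ => Z₁ y μ - R ψ y μ) ((tower L N (k + 1) : ℕ) : ℤ) := fun y i μ => by
    simp only [hZ₁P y i μ, hRper ψ hψs hψP y i μ]
  have hTT : dirIter L (k + 1) U (fun y μ => Z₁ y μ - R ψ y μ) = 0 := by
    rw [dirIter_sub hL k hUu hx hs hUx Z₁ (R ψ), hRexact ψ hψs hψP]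
    funext w τ
    simp [hψ]
  have hc := hcrit _ hTs hTP hTT
  rw [dAction_sub', sub_eq_zero] at hc
  -- `dAction U Z = dAction U Z₁ = dAction U (Rψ)`
  have hZZ₁ : dAction U Z (perWin d (tower L N (k + 1))) = dAction U Z₁ (perWin d (tower L N (k + 1))) := by
    have e1 : Z = fun y μ => Z₁ y μ - G y μ := by funext y μ; simp only [hZ₁]; abel
    conv_lhs => rw [e1]
    rw [dAction_sub', hG, dAction_gaugeDir, sub_zero]
  rw [hZZ₁, hc]
  refine (hRbd ψ hψs hψP).trans ?_
  -- `‖ψ‖₁ = ‖Q̄_U Z‖₁ ≤ (Λ + q^{k+1})‖Z‖₁`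
  have hψ1 : dirL1 ψ (periodBox (d := d) N) ≤ (Λ + ((L : ℝ) / (L : ℝ) ^ d) ^ (k + 1)) * dirL1 Z (periodBox (d := d) (tower L N (k + 1))) := by
    have h1 := hΛ Z hZ hZP
    have hZP' : IsPeriodicDir Z (((L ^ (k + 1) * N : ℕ) : ℤ)) := by rw [← htowN]; exact hZP
    have h2 := sum_norm_iterate_Qcoarse_le (d := d) (n := n) hL (k + 1) hN1 Z hZP'
    rw [← htowN] at h2
    unfold dirL1 at h1 h2 ⊢
    calc ∑ w ∈ periodBox N, ∑ τ : Fin d, ‖ψ w τ‖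
        ≤ ∑ w ∈ periodBox N, ∑ τ : Fin d, (‖QbarIter L (k + 1) U Z w τ - QbarIter L (k + 1) (flat (d := d) (n := n)) Z w τ‖
            + ‖(Qcoarse L)^[k + 1] Z w τ‖) := by
          refine Finset.sum_le_sum fun w _ => Finset.sum_le_sum fun τ _ => ?_
          rw [hψeq, ← QbarIter_flat hL (k + 1) Z]
          exact norm_le_norm_sub_add _ _
      _ = (∑ w ∈ periodBox N, ∑ τ : Fin d, ‖QbarIter L (k + 1) U Z w τ - QbarIter L (k + 1) (flat (d := d) (n := n)) Z w τ‖)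
          + ∑ w ∈ periodBox N, ∑ τ : Fin d, ‖(Qcoarse L)^[k + 1] Z w τ‖ := by
          rw [← Finset.sum_add_distrib]
          exact Finset.sum_congr rfl fun w _ => Finset.sum_add_distrib
      _ ≤ Λ * ∑ w ∈ periodBox (tower L N (k + 1)), ∑ τ : Fin d, ‖Z w τ‖
          + ((L : ℝ) / (L : ℝ) ^ d) ^ (k + 1) * ∑ w ∈ periodBox (tower L N (k + 1)), ∑ τ : Fin d, ‖Z w τ‖ := add_le_add h1 h2
      _ = _ := by ring
  calc cR * dirL1 ψ (periodBox (d := d) N) ≤ cR * ((Λ + ((L : ℝ) / (L : ℝ) ^ d) ^ (k + 1)) * dirL1 Z (periodBox (d := d) (tower L N (k + 1)))) :=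
        mul_le_mul_of_nonneg_left hψ1 hcR
    _ = _ := by ring

/-- **THE FIRST-VARIATION DENSITY OF A TANGENT-CRITICAL CONFIGURATION** (`R := rightInvW`, `c_R = a·(curl1C∕(1−θℓ))·(M^d∕M²)`, as F53): under F41 §1's hypotheses on
`U` (unitary, `(N·L^{k+1})`-periodic, class radius `x ≥ 0` with `LevelSmall d L k x`, `cruxC·M²x < 1`, `thetaLoc·M²x < 1`, `M²x ≤ 1`, `SmallField U a`, `a ≥ 0`, `L ≥ 2`),
the flat top average, the straight-tower letter `Λ` and TANGENT-CRITICALITY, every skew `(N·L^{k+1})`-periodic `Z` has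
`|dAction U Z (perWin)| ≤ a·(curl1C∕(1−θℓ))·(M^d∕M²)·(Λ + (L∕L^d)^{k+1})·‖Z‖_{ℓ¹(periodBox (N·L^{k+1}))}`. [folklore] -/
theorem abs_dAction_le_of_tanCritical [Nonempty n] {L : ℕ} (hL : 2 ≤ L) (k : ℕ) {N : ℕ} [NeZero N] {U : Site d → Fin d → (Matrix n n ℂ)ˣ} {x a Λ : ℝ}
    (hUu : IsUnitaryCfg U) (hUP : IsPeriodicCfg U ((N * L ^ (k + 1) : ℕ) : ℤ)) (hx : 0 ≤ x) (hs : LevelSmall d L k x) (hUx : SmallField U x)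
    (hθ : cruxC d L * (((L : ℝ) ^ (k + 1)) ^ 2 * x) < 1) (hθl : thetaLoc d L * (((L : ℝ) ^ (k + 1)) ^ 2 * x) < 1)
    (hε : ((L : ℝ) ^ (k + 1)) ^ 2 * x ≤ 1) (ha : 0 ≤ a) (hUa : SmallField U a)
    (hflatTop : cavgIter L (k + 1) U = flat)
    (hΛ : ∀ Y : Site d → Fin d → Matrix n n ℂ, IsSkewDir Y → IsPeriodicDir Y ((N * L ^ (k + 1) : ℕ) : ℤ) →
      ∑ z ∈ periodBox N, ∑ κ : Fin d, ‖QbarIter L (k + 1) U Y z κ - QbarIter L (k + 1) (flat (d := d) (n := n)) Y z κ‖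
        ≤ Λ * dirL1 Y (periodBox (d := d) (N * L ^ (k + 1))))
    (hcrit : ∀ Y' : Site d → Fin d → Matrix n n ℂ, IsSkewDir Y' → IsPeriodicDir Y' ((N * L ^ (k + 1) : ℕ) : ℤ) →
      dirIter L (k + 1) U Y' = 0 → dAction U Y' (perWin d (N * L ^ (k + 1))) = 0)
    {Z : Site d → Fin d → Matrix n n ℂ} (hZ : IsSkewDir Z) (hZP : IsPeriodicDir Z ((N * L ^ (k + 1) : ℕ) : ℤ)) :
    |dAction U Z (perWin d (N * L ^ (k + 1)))|
      ≤ ((a * ((curl1C d L / (1 - thetaLoc d L * (((L : ℝ) ^ (k + 1)) ^ 2 * x))) * (((L : ℝ) ^ (k + 1)) ^ d / ((L : ℝ) ^ (k + 1)) ^ 2)))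
          * (Λ + ((L : ℝ) / (L : ℝ) ^ d) ^ (k + 1))) * dirL1 Z (periodBox (d := d) (N * L ^ (k + 1))) := by
  classical
  have hL1 : 1 ≤ L := le_trans (by norm_num) hL
  have htowN : tower L N (k + 1) = N * L ^ (k + 1) := tower_eq L N (k + 1)
  have htow : ((tower L N (k + 1) : ℕ) : ℤ) = ((N * L ^ (k + 1) : ℕ) : ℤ) := by rw [htowN]
  have hUP' : IsPeriodicCfg U ((tower L N (k + 1) : ℕ) : ℤ) := by rw [htow]; exact hUP
  -- the right inverse as a plain function (classical case split on skewness), as F53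
  set R : (Site d → Fin d → Matrix n n ℂ) → Site d → Fin d → Matrix n n ℂ :=
    fun φ => if h : IsSkewDir φ then rightInvW hL k hUu hx hs hUx N hθ h else 0 with hR
  have hRdef : ∀ φ : Site d → Fin d → Matrix n n ℂ, ∀ h : IsSkewDir φ, R φ = rightInvW hL k hUu hx hs hUx N hθ h := fun φ h => by
    simp only [hR, dif_pos h]
  set cR : ℝ := a * ((curl1C d L / (1 - thetaLoc d L * (((L : ℝ) ^ (k + 1)) ^ 2 * x))) * (((L : ℝ) ^ (k + 1)) ^ d / ((L : ℝ) ^ (k + 1)) ^ 2))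
    with hcR
  have hcR0 : 0 ≤ cR := by
    have hpos : 0 < 1 - thetaLoc d L * (((L : ℝ) ^ (k + 1)) ^ 2 * x) := by linarith
    have := curl1C_nonneg d L
    rw [hcR]; positivity
  have hRskew : ∀ φ : Site d → Fin d → Matrix n n ℂ, IsSkewDir φ → IsPeriodicDir φ (N : ℤ) → IsSkewDir (R φ) := fun φ hφ _ => by
    rw [hRdef φ hφ]; exact rightInvW_skew hL k hUu hx hs hUx hθ hφ
  have hRper : ∀ φ : Site d → Fin d → Matrix n n ℂ, IsSkewDir φ → IsPeriodicDir φ (N : ℤ) →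
      IsPeriodicDir (R φ) ((tower L N (k + 1) : ℕ) : ℤ) := fun φ hφ _ => by
    rw [hRdef φ hφ, htow]; exact rightInvW_periodic hL k hUu hUP' hx hs hUx hθ hφ
  have hRexact : ∀ φ : Site d → Fin d → Matrix n n ℂ, IsSkewDir φ → IsPeriodicDir φ (N : ℤ) → dirIter L (k + 1) U (R φ) = φ := fun φ hφ hφP => by
    rw [hRdef φ hφ]; exact rightInvW_exact hL k hUu hUP' hx hs hUx hθ hφ hφP
  have hRbd : ∀ φ : Site d → Fin d → Matrix n n ℂ, IsSkewDir φ → IsPeriodicDir φ (N : ℤ) →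
      |dAction U (R φ) (perWin d (tower L N (k + 1)))| ≤ cR * dirL1 φ (periodBox (d := d) N) := fun φ hφ hφP => by
    rw [hRdef φ hφ, htowN]
    exact abs_dAction_rightInvW_le hL k hUu hUP' hx hs hUx hθ hθl hε ha hUa hφ
  have hΛ' : ∀ Y : Site d → Fin d → Matrix n n ℂ, IsSkewDir Y → IsPeriodicDir Y ((tower L N (k + 1) : ℕ) : ℤ) →
      ∑ z ∈ periodBox N, ∑ κ : Fin d, ‖QbarIter L (k + 1) U Y z κ - QbarIter L (k + 1) (flat (d := d) (n := n)) Y z κ‖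
        ≤ Λ * dirL1 Y (periodBox (d := d) (tower L N (k + 1))) := fun Y hY hYP => by
    rw [htowN]; rw [htow] at hYP; exact hΛ Y hY hYP
  have hcrit' : ∀ Y' : Site d → Fin d → Matrix n n ℂ, IsSkewDir Y' → IsPeriodicDir Y' ((tower L N (k + 1) : ℕ) : ℤ) →
      dirIter L (k + 1) U Y' = 0 → dAction U Y' (perWin d (tower L N (k + 1))) = 0 := fun Y' hY's hY'P hY'T => by
    rw [htowN]; rw [htow] at hY'P; exact hcrit Y' hY's hY'P hY'T
  have hZP' : IsPeriodicDir Z ((tower L N (k + 1) : ℕ) : ℤ) := by rw [htow]; exact hZP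
  have h := abs_dAction_le_of_tanCritical_gauge hL1 k hUu hUP' hx hs hUx hflatTop R hRskew hRper hRexact hcR0 hRbd hΛ' hcrit' hZ hZP'
  rw [htowN] at h
  simpa only [hcR] using h

/-! ## §3 The currency: `c_R·(Λ + (L∕L^d)^{k+1}) = C·δ·(1 + 2C_Sα̂)·M⁻³` -/

/-- **THE CURRENCY OF THE FIRST-VARIATION DENSITY**: with `M = L^{k+1}`, the plaquette radius `a = δM⁻²` and the tower letter `Λ = 2·(C_S·α̂)·(L∕L^d)^{k+1}` (F51), the
density `(δ∕M²·(C·(M^d∕M²)))·(2C_Sα̂(L∕L^d)^{k+1} + (L∕L^d)^{k+1})` equals `C·δ·(2C_Sα̂ + 1) ∕ M³` — [B8] (1.9)'s `α₀η³` with `α₀ = C(1 + 2C_Sα̂)δ`, every other `M`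
cancelled. [folklore] -/
theorem density_currency {L : ℕ} (hL : 1 ≤ L) (k d' : ℕ) (δ C CS αh : ℝ) :
    (δ / ((L : ℝ) ^ (k + 1)) ^ 2 * (C * (((L : ℝ) ^ (k + 1)) ^ d' / ((L : ℝ) ^ (k + 1)) ^ 2)))
        * (2 * (CS * αh) * ((L : ℝ) / (L : ℝ) ^ d') ^ (k + 1) + ((L : ℝ) / (L : ℝ) ^ d') ^ (k + 1))
      = C * δ * (2 * CS * αh + 1) / ((L : ℝ) ^ (k + 1)) ^ 3 := by
  have hM : (0 : ℝ) < (L : ℝ) ^ (k + 1) := pow_pos (by exact_mod_cast (show 0 < L by omega)) _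
  rw [show ((L : ℝ) / (L : ℝ) ^ d') ^ (k + 1) = (L : ℝ) ^ (k + 1) / ((L : ℝ) ^ (k + 1)) ^ d' by
    rw [div_pow, ← pow_mul, ← pow_mul, mul_comm d' (k + 1)]]
  have hMd : (0 : ℝ) < ((L : ℝ) ^ (k + 1)) ^ d' := pow_pos hM _
  field_simp

end

end Summit.QuantumFields.BalabanUV.T4Continuum.NE7CriticalFirstVariation
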